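import Summits.QuantumFields.YangMills.Theorems.BalabanUVNodesN12MinimiserFamilyKnitRowThm1LettersAtLengthOnZOfRecord
import Literature.MathematicalPhysics.QuantumFieldTheory.Balaban1983to89.Node00.MultiScaleFibreChartB
import Literature.MathematicalPhysics.QuantumFieldTheory.Balaban1983to89.Node00.Record12BgRowCoClassCPMFloorB
import Literature.MathematicalPhysics.QuantumFieldTheory.Balaban1983to89.B15Prop1MinimiserFamilyOfNormalisedSliceB
import Summits.QuantumFields.YangMills.Theorems.BalabanUVNodesN12MinimiserFamilyAtRecordBjTowerDatumLettersOnZUniformB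
import Summits.QuantumFields.YangMills.Theorems.BalabanUVNodesN12MinimiserFamilyKnitRowThm1LettersAtLengthOnZBR
import HarnessLib

/-!
# ★ REGULAR-REALISED-DATA EDITION (`…OnZOfRecordBR`, dag-n12-c g38): dag-n12-d g33's `…KnitRowThm1LettersAtLengthOnZOfRecordB` (✓p782607) VERBATIM except that the (E∕U) letter `h15EUT`
# reads `B11Thm1ExistsUniqueRealisedDataB.DataRegularRealisedTop …` as its data row and the knit row comes from `…KnitRowThm1LettersAtLengthOnZBR`; `h15T` keeps `Sect2.DataSmall7PTop`.
# PROVENANCE (O4).  Spec dag-n12-c g38 INBOX l.20148; allocation dag-lead WORDS 473 ∕ 474 (n12-d g34 «MINE» l.20163); bytes TYPED by dag-n12-c g38 (HOME `pub-ymgap-dag-n12-c/lean/g38/rekey/`,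
# handed over l.20181, sha16 7596c32e86256c53) and REVIEWED ∕ annotated ∕ filed by seat `pub-ymgap-dag-n12-d` g34 (R134 N12 [B15] s2).  Count-neutral helper of K1⁹ `stmt-QuantumFields-27364`,
# `--kind proof --supports … --as helper`.  THEOREMS ONLY (0 `def`, 0 `instance`, 0 `sorry`).
#
# BalabanUVNodes ∕ N12 — THE KNIT's (J0′) ROW FOR EVERY BASE FIELD OF THE STRICT GUARD, OF RECORD, AT-LENGTH EDITION: `N12MinimiserFamilyKnitRowThm1LettersAtLengthOnZ. — **BOND-DATUM EDITION** (`…N12MinimiserFamilyKnitRowThm1LettersAtLengthOnZOfRecordB`, USED DECLARATIONS ONLY)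

The print-datum ([Balaban1984PropagatorsII] (2.3)) (γ) twin of `Summits/…/Theorems/BalabanUVNodesN12MinimiserFamilyKnitRowThm1LettersAtLengthOnZOfRecord.lean`: the declarations of the parent whose STATEMENT reads the determining datum
(`exists_R_hMinRow_of_thm1LettersAtLength_alongOrbit_onZ_ofRecord`) and which N12's junction of record v14ᴸ uses (dag-n12-c g35 probe-2 census `UsedConstsN12RoadTyped2`, THEOREMS block), re-typed over a
BOND-LEVEL datum `𝔅 : BDetSet` (F0a `B15DeterminingSetsB`) and dag-n12-c's bond-datum chart `Node00.msChartB` (✓p774329; `msChart 𝐁 = msChartB (bondsDet 𝐁)` by `rfl`).  GENERATOR twin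
(this seat's `work/g32/gen_thm.py`, block-extracted from the parent's tree bytes): namespace `…N12MinimiserFamilyKnitRowThm1LettersAtLengthOnZOfRecordB`, SAME short names, `DetSet ↦ BDetSet`, `AgreeOn 𝐁 ↦ AgreeOnB 𝔅`,
`IsMinimizer ↦ IsMinimizerB`, `bondsOf (𝐁 j) ↦ 𝔅 j`, `msChart ∕ constrCard ∕ constrEnum ∕ ConstrSet ↦ …B`, NODE 00 chart lemmas `…msChart… ↦ …msChartB…`; proofs VERBATIM; the parent's
datum-free declarations REUSED BY NAME (`open`), never copied (private plumbing excepted, №366 R2).  The parent's (b) statements are the instances `𝔅 := bondsDet 𝐁`.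
THE KNIT ROW OF RECORD AT PRINT`s [II] (2.3) DATUM: 165`s `…_alongOrbit_onZ` with the per-height letters `ρ″ hsbU εH B hHB` DISCHARGED by dag-n12-w6`s `N12HsurjOfClass.exists_hsurjLetters` (the (b)-letter, inhabited per height — unchanged; 165 displays `hHB` in (b)-currency precisely so that this composition is by name); the two [15] letters over `lamBondsSeq s.Ω k`; conclusion over `IsMinimizerB … (lamBondsSeq (maxDomT ν.M₁ Z) k)`.
Cell `pub-ymgap` (HUMAN RULINGS D-0062 ∕ D-0149), seat `pub-ymgap-dag-n12-d` g32 (R134 N12 [B15] s2; the (ii) Theorems-side re-key of N12's road at print's [II] (2.3) datum — director-ym №338 ∕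
№343 (E1)(iii-b), FLAG №16 ∕ ruling (α); dag-n12-c DESIGN memo a793b2ebc0b803bf (ii); `N12-ROAD-TWIN-ORDER-2026-08-30.md`).  Count-neutral helper of K1⁹ `stmt-QuantumFields-27364`,
`--kind proof --supports … --as helper`.  THEOREMS ONLY (0 `def`, 0 `instance`, 0 `sorry`).

HONEST FRAMING (director-ym №338 (5)).  PURELY ADDITIVE: the parent stays landed and true on its own text; nothing in it is edited; no displayed premise of any consumer is deleted or
weakened; every hypothesis of the parent stays a hypothesis.  Nothing of Bałaban's analysis asserted; N12 NOT discharged; K0⁷ ∕ K1⁹ NOT closed; counts unmoved (typed 28∕28 · discharged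
8∕27, A 8∕28; K 1∕4); one finite 𝕋⁴ programme at fixed ε — R4 closes the conditional rung `BalabanLadder.UV` only; NOT the Yang–Mills mass gap (Clay); nothing continuum ∕ ℝ⁴ ∕ OS.

PARENT's DOCSTRING (the mathematics and the citations; read the site-level `𝐁` as the bond datum `𝔅`):
# BalabanUVNodes ∕ N12 — THE KNIT's (J0′) ROW FOR EVERY BASE FIELD OF THE STRICT GUARD, OF RECORD, AT-LENGTH EDITION: `N12MinimiserFamilyKnitRowThm1LettersAtLengthOnZ.
# exists_R_hMinRow_of_thm1LettersAtLength_alongOrbit_onZ` with the per-height letters DISCHARGED (dag-n12-w6's `N12HsurjOfClass.exists_hsurjLetters`) — displayed: the record numerics,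
# dag-n12-w6's (σ)_N numerics, the two [15] letters `h15T` ∕ `h15EUT` READ AT THE INSTANCE's OWN LENGTH `k`; announced: `ρ″`, `εH`, `δ₀`; then per window ∕ region box ∕ tolerances: `∃ R > 0, ∀ V_k, strict guard → <12Q ∕ 12X-W v11 hMin ∀-body, bound 4𝓐₀>`
# ([Balaban1985Variational] (1) p.277, (2)–(7) p.278, Thm 1 (8) p.279, Sect. C (44)–(48) p.285, (81)–(83) p.290, Sect. G pp.305–307, (181) p.307, Prop. 9 (190) p.309;
# [Balaban1989LargeFieldI] (1.74) p.192, p.193 ll.14–20, Prop. 1 p.194; [Balaban1985RegularSpaces] (1.3)–(1.9) p.77; [Balaban1989LargeFieldII] p.357, (1.7)–(1.9) p.358,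
# (1.12)–(1.13) p.359; [Balaban1988Convergent] (2.1)–(2.2) pp.254–255, (2.10)–(2.13) pp.256–257, (2.18) p.257; [Balaban1985Averaging] (8)–(9) pp.18–19, Prop. 2 (52)–(54) p.26,
# (122)–(126) p.36; [Balaban1987RG1] (0.4) p.253)

Cell `pub-ymgap` (HUMAN RULINGS D-0062 ∕ D-0149), seat `pub-ymgap-dag-n12-d` g26 (R134 N12 [B15] s2 = by-name knit at the record; census item E1 = the (J0′) row; count-neutral helper of K1⁹
`stmt-QuantumFields-27364`, `--kind proof --supports … --as helper`).  THEOREMS ONLY (0 `def`, 0 `instance`, 0 `sorry`); ONE composition BY NAME.  AT-LENGTH EDITION of this seat's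
`…KnitRowThm1LettersOnZOfRecord` (p735556, g25) ∕ the lane dag-n12-c g29's length-guarded re-key `…KnitRowThm1LettersOnZOfRecordPos` (p739277) — the text of the latter byte for byte
except the two [15] letter binders (now AT THE INSTANCE's LENGTH `k`, no `∀ k'`), the junction called (`…KnitRowThm1LettersAtLengthOnZ.exists_R_hMinRow_of_thm1LettersAtLength_alongOrbit_onZ`),
names and this header.  Seventh leaf of the junction family (own leaf for the 400-line rule).

WHAT.  The onZ junction of record (`…KnitRowThm1LettersOnZ` §2, p734359) displays per (instance, height) the existence letters `ρ″`∕`hsbU` ([4]'s averaging smallness radius) and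
`εH`∕`B`∕`hHB` (the bounded right inverse of the constrained chart's derivative) — inhabited, for every instance and height, by dag-n12-w6 g11's `N12HsurjOfClass.exists_hsurjLetters`
(`ρ″, εH` from `(Kt, k)` alone, `B` per `(M₁, Z)`).  THIS FILE discharges them: what stays displayed is the record numerics (`3 ≤ d`, `1 ≤ k`, `k + 1 ≤ m + K`, `LᵏM₁`-side ∣ `sitesPerDir 0`,
`(d+14)L ≤ M₁`, `IsBlockUnion k Z`), the (σ)_N numerics (`hkc hc hMrad hM₁`) and the two [15] letters `h15T` ((8)) ∕ `h15EUT` (existence ∕ uniqueness modulo tower-central gauges) over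
NODE 00's torus class READ AT THE INSTANCE's OWN LENGTH `k` (no quantification over lengths); ANNOUNCED: `ρ″ > 0`, `εH > 0`, `δ₀ > 0`; then for every fine window with 12Q v11's geometry rows, print's region box (lit-balaban ME #45∕#46: print's own
scope — every class-(i) component of `Z` is a rectangular parallelepiped inside a `100MR_k`-cube, [Balaban1988Convergent] p.255 after (2.3), [Balaban1989LargeFieldI] (i) p.177; `Λ` a box), guard radius `eR` within the budget, extension, `𝓐₀ > 1`, class tolerance `εr` (five rows + [15]'s comparability rows at `ε := 2eR`), datum
tolerance `ρn` (U3's «T ≤ δ₀» + the normaliser's coupling): `∃ R > 0, ∀ V_k, PlaqSmallOn (plaqsInside (pts k (Z ∩ Λᶜ))) eR V_k → <the knit's hMin ∀-body at V_k, radius R, bound 4𝓐₀,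
class at εr>`.

WHY AT LENGTH (dag-n12-d g26; LOCATED typing-strength of a displayed letter vs its producer of record, count-neutral).  The `_pos` editions display `h15T` ∕ `h15EUT⁺` quantified over ALL
lengths `k' ≤ m + K` although the junction reads them once, at `k' = k`.  The (8)-letter's producer of record is the K0 road, whose REGISTERED currency (K0⁷ stmt-QuantumFields-20541,
skeleton V22-Z: stub-1 text `K0V22ZDefs.Prop8StepCoPGridGAt F` → dag-n07-e's `variationalThm1RegSepCoP7MG_of_prop8TopStepG`) is the GRID-GUARDED sentence
`Node00.VariationalThm1RegSepCoP7MG F 2 A‴(c, c₀, c₁) B₃ a₀ a₁` — it serves the torus-class letter only at lengths `k'` with `k' + c₀ ≤ m + K` (and numerics `c ≤ M₁`, `L^{c₁} ∣ M₁`), never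
at all `k' ≤ m + K`; the floor-free `…SepCoP7M` named in the «INHABITED BY» comments implies every guarded sentence (`.toG`), not conversely.  THIS EDITION therefore displays both
letters AT THE INSTANCE's OWN LENGTH `k`, so that ANY producer guarded in the length serves exactly the instances passing its guard — the K0-keyed head is
`BalabanUVNodesN12MinimiserFamilyKnitRowOfK0GridGOnZOfRecord` (next leaf) — and the `_pos` letters serve every instance (instantiate at `k`).  Proof: ✓p739277's, the junction renamed.

HONEST FRAMING ∕ LOCATED.  One composition by name; [15] Thm 1 ((8), existence, uniqueness) stays DISPLAYED as the two letters `h15T`∕`h15EUT` at the instance's length `k ≥ 1` (producer of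
`h15T` = the K0 road's guarded (8)-token at instances passing its guard, K0⁷ OPEN; `h15EUT` = [15] Thm 1 (E∕U) has NO producer in the tree — orphan edge N07→N12) — THE remaining substance of E1 on the knit side, together with census U4 (`δ₀`, `R`, `ρ″`, `εH` are EXISTENCE constants per (instance, height); print's volume-uniform
(46)∕(83) and `k`-uniformity NOT claimed); box scope displayed; nothing of Bałaban's estimates asserted; count-neutral; N12 NOT discharged; K1⁹ NOT closed; counts unmoved; one finite 𝕋⁴
programme at fixed `ε = L^{-K}` — R4 closes only the conditional rung `BalabanLadder.UV`; no summit statement is proved here and NOT the Yang–Mills mass gap (Clay); nothing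
continuum ∕ ℝ⁴ ∕ OS.
-/

noncomputable section

namespace Summit.QuantumFields.YangMills.BalabanUVNodes.N12MinimiserFamilyKnitRowThm1LettersAtLengthOnZOfRecordBR

open Literature.MathematicalPhysics.QuantumFieldTheory.Balaban1983to89.B15DeterminingSetsB

open scoped BigOperators Matrix.Norms.L2Operator Topology
open Literature.MathematicalPhysics.QuantumFieldTheory.Balaban1983to89
open T4Continuum
open B15DeterminingSets GaugeField
open ExpMeanLog (expMeanLogSU deltaSU)
open T4AdjointCovarianceUnitary (lieSU)
open Node00
open B15Prop1AnalyticExtClause (cplxVec)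
open B15Prop1ChartCalculusSU2 (E3)
open T4CubeChartGnomonic (SU2)
open B14.Eq213DetSet (Bj maxDomT)
open B14.Eq213MaximalDomains (side)
open B14.Eq22Determines (IsBlockUnion)
open B14.Eq216Concrete (feeds)
open B5Eq118OneStroke (iterBlockOf)
open B15Eq112TorusCover (lift)
open T4AxialGaugeSmallField (boxPlaqs castSite)
open B15Prop1Carrier (plaqsInside)
open Literature.MathematicalPhysics.QuantumFieldTheory.BalabanImbrieJaffe1984to88.BIJ85Eq453GaugeField (qsstarGIter0)
open B15ShellGauge193 (shellGauge)
open B15Extension193 (extend)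
open B16Sect1Backgrounds (toMS expMul)
open B15Prop1ChartSU2 (su2Chart)
open Metric (ball)
open B15Prop1ClosedGuardUniformRadius (isCompact_setOf_plaqLeOn plaqLeOn_of_plaqSmallOn)
open B15ShellGauge193Local (dist1_plaqHol_extend_shellGauge_le)
open B15Extension193 (cutoff primed Touches)
open B12ContinuousTransportInvarianceOn (continuous_dist1_SU)
open T4AxialGaugeSmallField (boxBonds)
open B15Prop1MinimiserFamilyOfNormalisedSliceB (hMinBody_of_datumSlice)
open Summit.QuantumFields.YangMills.BalabanUVNodes.N12MinimiserFamilyKnitRowThm1Letters (boxRow3_of_boxRow5 isCompact_guard_inter_datumSlice)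
open Summit.QuantumFields.YangMills.BalabanUVNodes.N12MinimiserFamilyAtRecordBjTowerDatumLettersOnZUniformB (hMin_atRecord_lamBondsSeq_of_printLetters_ofClassDatumLettersOnZUniform)
open Summit.QuantumFields.YangMills.BalabanUVNodes.N12MinimiserFamilyKnitRowThm1LettersAtLengthOnZBR (exists_R_hMinRow_of_thm1LettersAtLength_alongOrbit_onZ)

open Summit.QuantumFields.YangMills.BalabanUVNodes.N12HsurjOfClass (exists_hsurjLetters)
open Node00 (msChart constrCard constrEnum)

section
variable {F : T4Family} {k : ℕ}

/-- ★★★★★ **THE KNIT's (J0′) ROW FOR EVERY BASE FIELD OF THE STRICT GUARD, PER-HEIGHT LETTERS DISCHARGED, [15] LETTERS AT THE INSTANCE's LENGTH** —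
`N12MinimiserFamilyKnitRowThm1LettersAtLengthOnZB.exists_R_hMinRow_of_thm1LettersAtLength_alongOrbit_onZ` ∘ dag-n12-w6's `N12HsurjOfClass.exists_hsurjLetters` (at `M₁ := ν.M₁`, `1 ≤ M₁` from the
floor): displayed ONLY the record numerics, the (σ)_N numerics `hkc hc hMrad hM₁` and the two [15] letters `h15T`∕`h15EUT` READ AT THIS INSTANCE's LENGTH `k`; announced `ρ″ > 0`, `εH > 0`, `δ₀ > 0`; then per window (rows `hn hN5 hlohi hbox hZ`), region box
(`LO HI n′` rows + box scope), `cE` + budget, `ext`, `𝓐₀`, `εr` (five rows), `ε₀` (four comparability rows at `ε := 2eR`), `ρn` («T ≤ δ₀», coupling):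
`∃ R > 0, ∀ V_k, strict guard → <12Q ∕ 12X-W v11 hMin ∀-body at V_k, bound 4𝓐₀, class at εr>`.
[cite: Balaban1985Variational, (2)–(7) p.278, Thm 1 (8) p.279, Sect. C (44)–(48) p.285, (81)–(83) p.290, Sect. G pp.305–307, (181) p.307, Prop. 9 (190) p.309; Balaban1989LargeFieldI, (i) p.177, (1.74) p.192, p.193 L14–20, Prop. 1 p.194; Balaban1988Convergent, p.255 (after (2.3)); Balaban1985RegularSpaces, (1.3)–(1.9) p.77; Balaban1989LargeFieldII, (1.12)–(1.13) p.359; Balaban1988Convergent, (2.1)–(2.2) pp.254–255, (2.10)–(2.13) pp.256–257, (2.18) p.257; Balaban1985Averaging, (8)–(9) pp.18–19, Prop. 2 (52)–(54) p.26, (122)–(126) p.36; Balaban1987RG1, (0.4) p.253] -/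
theorem exists_R_hMinRow_of_thm1LettersAtLength_alongOrbit_onZ_ofRecord (ν : Node00.Stage7Numerics) (Kt : ℕ) (hd3 : 3 ≤ (F.P Kt).d) (Z : Set (Site (F.P Kt) 0))
    (hkK : k + 1 ≤ (F.P Kt).m + (F.P Kt).K) (hk1 : 1 ≤ k) (hdiv : side (F.P Kt).L ν.M₁ k ∣ (F.P Kt).sitesPerDir 0) (hfloor : ((F.P Kt).d + 14) * (F.P Kt).L ≤ ν.M₁) (hZblk : IsBlockUnion k Z)
    -- (σ)_N OF RECORD, onZ EDITION (dag-n12-w6 g18's `N12GaugeLetterLocExplicitOnZLam.exists_gaugeLetterLoc_atRecord_lamBondsSeq_explicit_onZ` inside the lane's U3-onZ), instance-level NUMERICS verbatim: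
    -- NUMERICS (i): a level guard `k + c ≤ m + K` with `4d + m′ + 3 < 2·L^c` (no wrapping), and `M₁ ≥ (4d + m′)·L² + 2d·L + 12` (radii), `m′ = 3·(d·((L−1)∕2)) + 5`
    {c : ℕ} (hkc : k + c ≤ (F.P Kt).m + (F.P Kt).K) (hc : 4 * (F.P Kt).d + (3 * ((F.P Kt).d * (((F.P Kt).L - 1) / 2)) + 5) + 3 < 2 * (F.P Kt).L ^ c)
    (hMrad : (4 * (F.P Kt).d + (3 * ((F.P Kt).d * (((F.P Kt).L - 1) / 2)) + 5)) * (F.P Kt).L ^ 2 + 2 * (F.P Kt).d * (F.P Kt).L + 12 ≤ ν.M₁)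
    -- the family's support numerics: `M₁ ≥ ((d+4)L + 6)·L²`
    (hM₁ : (((F.P Kt).d + 4) * (F.P Kt).L + 6) * (F.P Kt).L ^ 2 ≤ ν.M₁)
    -- THE TWO [15]-THEOREM-1 LETTERS over NODE 00's torus class, READ AT THIS INSTANCE's OWN LENGTH `k`; the (8)-letter `h15T` with the record's (7) row `Sect2.DataSmall7PTop`, the (E∕U)
    -- letter `h15EUT` AT REGULAR-REALISED DATA `B11Thm1ExistsUniqueRealisedDataB.DataRegularRealisedTop …` (dag-n12-c g38 ✓p782648; rows by its `B15Prop1Thm1RowsOfExistsUniqueAtLengthBR`).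
    -- «INHABITED BY» at `bd := lamDatumP` and K0⁷'s grid guard `A‴(c,c₀,c₁)`: `h15T` = the body of the (R)ᴮ name `Node00.VariationalThm1RegSepCoP7MGB F 2 A‴ (lamDatum F) (dataSmall7LamTopOf F 2) …`
    --   through the record's (7) (113 §5) — INHABITED for K0⁷'s stub-1 constants (`K0Stub1BHolds`, 114 ✓p774580); `h15EUT` = the body of the (E∕U)ᴮ name
    --   `B11Thm1ExistsUniqueTokensGB.VariationalThm1EUSepCoP7MGB F 2 A‴ (lamDatum F) (dataRegularRealisedTopOf F 2) …`, which dag-n12-c's `…N12Thm1EUNameBOfStepAtRealisedDataLam` ✓p782822∕✓p782912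
    --   derives from THE ONE-LENGTH STEP TOKEN `VariationalThm1EUStepCoP7MGB F 2 A‴ (lamDatum F) (dataSmall7LamTopOf F 2) C₁ …` ([15] Prop. 2 + Sects. B–E at one length — OPEN, N07);
    --   the composition is dag-n12-d's `…LettersDischargedAtLengthOfK0Stub1BAndStepOfRecord`
    {B₃ a₀ a₁ : ℝ}
    (h15T : ∀ (s : B14.Eq218Concrete.Seq (fun n : ℕ => Node00.unionsOfCubes (F.P Kt) (side (F.P Kt).L ν.M₁ n)) k),
      Node00.Sect2.SeqSeparated ν.M₁ s → 0 < ν.M₁ →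
      ∀ (ε₀ : ℝ) (δ : ℕ → ℝ), (∀ j, j ≤ k → 0 < δ j ∧ δ j ≤ a₁ ∧ B₃ * δ j ≤ ε₀) → (∀ j, j < k → δ j ≤ 2 * δ (j + 1)) →
      (∀ j, j < k → δ (j + 1) ≤ 2 * δ j) → ε₀ ≤ a₀ →
      ∀ W : MSField (F.P Kt) SU2,
        Node00.Sect2.DataSmall7PTop (Node00.avOfRecord F 2 Kt) s.Ω (Node00.suppDomOfRecord F ν Kt s.Ω) k δ W →
        ∀ U₀ : GaugeField (F.P Kt) 0 SU2, IsMinimizerB (Node00.avOfRecord F 2 Kt)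
            {U | (∀ j, j ≤ k → PlaqSmallOn (Node00.Sect2.omegaPlaqsTop s.Ω (Node00.suppDomOfRecord F ν Kt s.Ω) j)
                (ε₀ * (F.P Kt).eta j ^ 2) U) ∧
              Node00.Sect2.CoDivClassOnTop s.Ω (Node00.suppDomOfRecord F ν Kt s.Ω) k ε₀ U}
            (lamBondsSeq s.Ω k) W U₀ →
          (∀ j, j ≤ k → PlaqSmallOn (Node00.Sect2.omegaPlaqsTop s.Ω (Node00.suppDomOfRecord F ν Kt s.Ω) j)
              (B₃ * δ j * (F.P Kt).eta j ^ 2) U₀) ∧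
            ∀ j, j ≤ k → Node00.Sect2.CoDivSmallOn (Node00.Sect2.omegaBondsTop s.Ω (Node00.suppDomOfRecord F ν Kt s.Ω) j)
              (B₃ * δ j * (F.P Kt).eta j ^ 3) U₀)
    (h15EUT : ∀ (s : B14.Eq218Concrete.Seq (fun n : ℕ => Node00.unionsOfCubes (F.P Kt) (side (F.P Kt).L ν.M₁ n)) k),
      Node00.Sect2.SeqSeparated ν.M₁ s → 0 < ν.M₁ →
      ∀ (ε₀ : ℝ) (δ : ℕ → ℝ), (∀ j, j ≤ k → 0 < δ j ∧ δ j ≤ a₁ ∧ B₃ * δ j ≤ ε₀) → (∀ j, j < k → δ j ≤ 2 * δ (j + 1)) →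
      (∀ j, j < k → δ (j + 1) ≤ 2 * δ j) → ε₀ ≤ a₀ →
      ∀ W : MSField (F.P Kt) SU2,
        B11Thm1ExistsUniqueRealisedDataB.DataRegularRealisedTop (Node00.avOfRecord F 2 Kt) s.Ω (Node00.suppDomOfRecord F ν Kt s.Ω) k δ W →
        (∃ U₀ : GaugeField (F.P Kt) 0 SU2, IsMinimizerB (Node00.avOfRecord F 2 Kt)
            {U | (∀ j, j ≤ k → PlaqSmallOn (Node00.Sect2.omegaPlaqsTop s.Ω (Node00.suppDomOfRecord F ν Kt s.Ω) j)
                (ε₀ * (F.P Kt).eta j ^ 2) U) ∧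
              Node00.Sect2.CoDivClassOnTop s.Ω (Node00.suppDomOfRecord F ν Kt s.Ω) k ε₀ U}
            (lamBondsSeq s.Ω k) W U₀) ∧
        ∀ U₁ U₂ : GaugeField (F.P Kt) 0 SU2,
          IsMinimizerB (Node00.avOfRecord F 2 Kt)
            {U | (∀ j, j ≤ k → PlaqSmallOn (Node00.Sect2.omegaPlaqsTop s.Ω (Node00.suppDomOfRecord F ν Kt s.Ω) j)
                (ε₀ * (F.P Kt).eta j ^ 2) U) ∧
              Node00.Sect2.CoDivClassOnTop s.Ω (Node00.suppDomOfRecord F ν Kt s.Ω) k ε₀ U}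
            (lamBondsSeq s.Ω k) W U₁ →
          IsMinimizerB (Node00.avOfRecord F 2 Kt)
            {U | (∀ j, j ≤ k → PlaqSmallOn (Node00.Sect2.omegaPlaqsTop s.Ω (Node00.suppDomOfRecord F ν Kt s.Ω) j)
                (ε₀ * (F.P Kt).eta j ^ 2) U) ∧
              Node00.Sect2.CoDivClassOnTop s.Ω (Node00.suppDomOfRecord F ν Kt s.Ω) k ε₀ U}
            (lamBondsSeq s.Ω k) W U₂ →
          ∃ u : GaugeTransf (F.P Kt) 0 SU2,
            (∀ j, j ≤ k → ∀ b ∈ lamBondsSeq s.Ω k j, toMS u j b.src = toMS u j b.tgt ∧ ∀ g : SU2, toMS u j b.src * g = g * toMS u j b.src) ∧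
              gaugeAct u U₁ = U₂) :
    -- the per-height letters DISCHARGED (dag-n12-w6 `N12HsurjOfClass.exists_hsurjLetters`): the radius `ρ″` and the window tolerance `εH` announced from (instance, height) alone
    ∃ ρ'' εH : ℝ, 0 < ρ'' ∧ 0 < εH ∧
    ∃ δ₀ : ℝ, 0 < δ₀ ∧
    ∀ (Λ : Set (Site (F.P Kt) 0)) (lo hi : Fin (F.P Kt).d → ℤ) (eR : ℝ), 0 < eR →
    ∀ (n : ℕ), (∀ κ, hi κ ≤ lo κ + n) → (∀ κ, ((hi κ - lo κ + 1).toNat : ℤ) + 5 < ((F.P Kt).sitesPerDir k : ℤ)) → lo ≤ hi →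
      pts k Λ = (castSite '' Set.Icc lo hi : Set (Site (F.P Kt) k)) → (boxPlaqs (lo - 1) (hi + 1) : Set (Plaq (F.P Kt) k)) ⊆ plaqsInside (pts k Z) →
    -- THE REGION BOX of the direct road (dag-n12-w6 §7's big box): `LO ≤ lo − 1`, `hi + 1 ≤ HI`, side budget `n′ < sitesPerDir k`, its plaquettes inside `Z^{(k)}`, and BOX SCOPE: every `k`-bond inside `Z^{(k)}` is a bond of the box
    -- (= print's STANDING shape condition on the class-(i) large-field components: [Balaban1988Convergent] p.255 after (2.3) «if a component of Z_j is contained in a cube of the size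
    -- 100MR_j, then it is a rectangular parallelepiped», [Balaban1989LargeFieldI] (i) p.177 — lit-balaban ME #45∕#46; not a narrowing of print's instance family)
    ∀ (LO HI : Fin (F.P Kt).d → ℤ) (n' : ℕ), LO ≤ lo - 1 → hi + 1 ≤ HI → (∀ κ, HI κ ≤ LO κ + n') → n' < (F.P Kt).sitesPerDir k →
      (boxPlaqs LO HI : Set (Plaq (F.P Kt) k)) ⊆ plaqsInside (pts k Z) → {e : PBond (F.P Kt) k | e.src ∈ pts k Z ∧ e.tgt ∈ pts k Z} ⊆ boxBonds LO HI →
    ∀ {cE : ℝ}, 12 * ((F.P Kt).d : ℝ) * ((n : ℝ) + 2) ^ 2 ≤ cE → 6 * ((((F.P Kt).d - 1 : ℕ)) : ℝ) * (F.P Kt).L ^ k * (2 * ((cE + 1) * eR)) ≤ ρ'' →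
    ∀ (ext : GaugeField (F.P Kt) k SU2 → GaugeField (F.P Kt) k SU2), (∀ W, ext W = extend (pts k Λ) (shellGauge W lo hi) W) →
    ∀ {𝓐₀ : ℝ}, 1 < 𝓐₀ →
    ∀ (εr : ℝ), 0 < εr → 12 * ((((F.P Kt).d - 1 : ℕ)) : ℝ) * (F.P Kt).L * εr ≤ ρ'' → εr ≤ εH →
      (143 * (((((F.P Kt).d + 4 : ℕ) : ℝ)) ^ 2 / 4) ^ 2) * (2 * ((F.P Kt).L : ℝ) ^ 2 * εr) ≤ 1 / 3 →
      2 * (2 * ((F.P Kt).L : ℝ) ^ 2 * εr) ≤ 2 * deltaSU (Fin 2) / ((((F.P Kt).d + 4) * (F.P Kt).L : ℕ) : ℝ) ^ 2 →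
    -- [15]'s comparability rows at `ε := 2eR`
    ∀ {ε₀ : ℝ}, (cE + 1) * (2 * eR) ≤ a₁ → B₃ * ((cE + 1) * (2 * eR)) ≤ εr → εr < ε₀ → ε₀ ≤ a₀ →
    -- the datum bond tolerance `ρn` with U3's «`T(ρn, εr) ≤ δ₀`» row (VERBATIM)
    ∀ {ρn : ℝ}, 0 ≤ ρn →
    (max ρn ((((2 * (∑ i ∈ Finset.range (k + 1), ((F.P Kt).d * (((F.P Kt).L ^ i - 1) / 2) + 1)) + 1 +
                  (3 * ((F.P Kt).d * (((F.P Kt).L - 1) / 2)) + 5) * (F.P Kt).L ^ k : ℕ) : ℝ)) ^ 2 / 4 * (εr * (F.P Kt).eta 0 ^ 2) +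
                ((3 * ((F.P Kt).d * (((F.P Kt).L - 1) / 2)) + 5 : ℕ) : ℝ) * (6 * ((((((F.P Kt).d + 2) * (F.P Kt).L : ℕ) : ℝ) ^ 2 / 4) * (2 * (εr * (F.P Kt).L ^ 2))) * ∑ i ∈ Finset.range k, ((F.P Kt).L : ℝ) ^ i) + ((3 * ((F.P Kt).d * (((F.P Kt).L - 1) / 2)) + 5 : ℕ) : ℝ) * ρn) ≤ δ₀) →
    -- the normaliser's bond tolerance (dag-n12-w6 §7, at `ε := eR`) below the datum tolerance `ρn`
    (((F.P Kt).d : ℝ) * n' + 1) * ((((F.P Kt).d - 1 : ℕ) : ℝ) * n' * ((12 * (F.P Kt).d * (n + 2) ^ 2 + 1) * eR) + 3 * (F.P Kt).d * (n + 2) ^ 2 * eR) ≤ ρn →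
    -- NO PER-BASE-FIELD HYPOTHESIS AND NO ANTECEDENT: the knit's `hMin` ∀-body for EVERY base field of the strict guard, bound `4𝓐₀`
    ∃ R : ℝ, 0 < R ∧ ∀ Vk : GaugeField (F.P Kt) k SU2, PlaqSmallOn (plaqsInside (pts k (Z ∩ Λᶜ))) eR Vk →
      ∃ Ũ : VecField (F.P Kt) k (EuclideanSpace ℂ (Fin 3)) × VecField (F.P Kt) k (EuclideanSpace ℂ (Fin 3)) → PBond (F.P Kt) 0 → Matrix (Fin 2) (Fin 2) ℂ,
        (∀ b i j, DifferentiableOn ℂ (fun z => Ũ z b i j) (ball 0 R)) ∧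
        (∀ z ∈ ball (0 : VecField (F.P Kt) k (EuclideanSpace ℂ (Fin 3)) × VecField (F.P Kt) k (EuclideanSpace ℂ (Fin 3))) R, ∀ b i j, ‖Ũ z b i j‖ ≤ 4 * 𝓐₀) ∧
        ∀ p B' : VecField (F.P Kt) k E3, ‖p‖ < R → ‖B'‖ < R → ∃ U' : GaugeField (F.P Kt) 0 SU2,
          (∀ b, Ũ (cplxVec p, cplxVec B') b = ((U' b : SU2) : Matrix (Fin 2) (Fin 2) ℂ)) ∧
            IsMinimizerB (Node00.avOfRecord F 2 Kt) (Node00.regMSCoPOfRecord F 2 {ν with εreg := εr} Kt k (maxDomT ν.M₁ Z)) (lamBondsSeq (maxDomT ν.M₁ Z) k)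
              (avgFamily (Node00.avOfRecord F 2 Kt) (qsstarGIter0 k (expMul su2Chart B' (ext (expMul su2Chart p Vk))))) U' := by
  obtain ⟨ρ'', εH, hρ, hεH0, hsbU, hH⟩ := exists_hsurjLetters (F := F) (k := k) Kt hkK
  have hM1 : 1 ≤ ν.M₁ := by
    have hL := (F.P Kt).L_pos
    nlinarith
  obtain ⟨B, hB0, hHB⟩ := hH ν.M₁ hM1 Z hdiv
  obtain ⟨δ₀, hδ₀, h⟩ := exists_R_hMinRow_of_thm1LettersAtLength_alongOrbit_onZ ν Kt hd3 Z hkK hk1 hdiv hfloor hZblk hsbU hρ hHB hB0 hkc hc hMrad hM₁ h15T h15EUT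
  exact ⟨ρ'', εH, hρ, hεH0, δ₀, hδ₀, h⟩

end

end Summit.QuantumFields.YangMills.BalabanUVNodes.N12MinimiserFamilyKnitRowThm1LettersAtLengthOnZOfRecordBR

end
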